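import Summits.QuantumFields.YangMills.Theorems.BalabanUVNodesN16HolderSlotWindow

/-!
# Route «BalabanUVNodes», cluster K4 «SpineRates» — node N16 = NE3 AT A TUPLE RATE READING, BINDER-GENERIC EDITION: the N16 conjunct of a K3 skeleton's `KeyedRates rr` for a
# tuple reading `rr : (F : T4Family) → (θ : Θ F) → P F θ → (ℕ → ℝ) → List (ULoop F) → RateCarriers N` over an ARBITRARY key type `Θ : T4Family → Type*`, proviso
# `P : (F : T4Family) → Θ F → Prop` and admissibility predicate `A : (F : T4Family) → Θ F → Prop` — so that NEITHER a proviso re-key (‴ → ⁗ → Core → ⁵ …) NOR a BINDER re-type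
# (record 13 v1.6 `CoPR`: `Stage13Params ↦ Stage13RParams`, director-ym №174) touches N16's tuple-currency statements again: every edition is the instance
# `Θ := (Stage13Params · N)` resp. `(Stage13RParams · N)`, `P := (·.Provisos₁₃… · N)`, `A := (·.Admissible · N)`, found by unification from the types of `rr` and of the hypotheses

Cell `pub-ymgap`, seat `pub-ymgap-dag-n16-e` (R134 acceleration seat (a), strategy s2 = BY-NAME KNIT at the record; HUMAN RULING D-0062; chair R424 venue), generation 8,
module 21ᴳᴳ (THEOREMS ONLY, 0 `def`, 0 `sorry`, standard axioms) = the `(Θ, A)`-generalisation of this seat's proviso-generic module 21ᴳ `…N16AtTupleReading13Generic` (p512669: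
`Θ F = Stage13Params F N`, `A F θ = θ.Admissible F N` — same statements under that instance, same proofs).  `bears_on: R4∕N16 · K3⁵ SpineGivenEndpointR13SepCoP
(stmt-QuantumFields-20296; dag-lead WORDS-141) → K3⁶ after plan rev 22 (WORDS-142)`; filed `--kind proof --supports stmt-QuantumFields-20296 --as helper`.  Imports ONLY this seat's
Stage-12 file 18 `…N16HolderSlotWindow` (p485315; through it `InEndRegime`, `LeafSlot`, the closer `n16At_of_inEndRegime_leafSlot`, the STAGE-FREE per-family window lemmas
`N16SlotWindowLinear.inEndRegime_and_leafSlot_ofRecord_of_window_linear` (p484035) and `N16HolderSlotWindow.inEndRegimeH_and_leafSlotHolder_ofRecord_of_window_linear`, dag-n16-c's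
β-kit `N16HolderAt` ∕ `InEndRegimeH` ∕ `LeafSlotHolder` ∕ `n16HolderAt_of_inEndRegimeH_leafSlotHolder` ∕ `n16HolderAt_of_n16At`, RR-1's `Node00/RateRecord11NE3Data`: `ne3ConstLayerOfRecord₁₁`,
`ne3NperOfRecord₁₁`, `ne3DomOfRecord₁₁`) — NO record module: no `Stage13Params`, no `Admissible`, no proviso structure is named in a statement below.  Restates nothing; the
skeletons' `RateReading N` abbrev is SPELLED OUT as its Π-type with key, proviso and admissibility slots variables (restate-immune: no Theses import).

WHY (pub-ymgap INBOX, 2026-08-27: director-ym №174 l.19279 PRESS WORD v1.6 → rev 22; node00-def-T FILE 25 `Node00/Record13CoPR.lean` p529474, KEY-RULE-25 ∕ KEYMAP v1.6: binder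
`θ : Stage13Params F N ↦ θ : Stage13RParams F N` (`structure Stage13RParams … extends Stage13Params` with the one new field `Zr`), `Provisos₁₃Core ↦ Stage13RParams.Provisos₁₃CoPR`;
dag-lead DEDUP-286 «every CoP consumer pen ports its OWN files»).  Module 21ᴳ made the PROVISO slot a variable but kept the binder TYPE `Stage13Params F N`; the v1.6 edition moves
the binder type itself, so 21ᴳ's theorems do not instantiate at a `Stage13RParams`-keyed reading (dag-n22-e's `rateCarriersOfRecord₁₃CoPR`, `readingOfRecord₁₃CoPR`).  N16 reads
NOTHING of the key `θ` (its NE3 component is pinned at RR-1's θ-FREE object of record by `hpin`; admissibility enters only as an opaque hypothesis of the binder), so the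
key type, the proviso and the admissibility predicate are ALL opaque slots: THIS module types them as variables once, and this seat's `…13CoPR` ports cite it at
`Θ := (Stage13RParams · N)`, the ‴∕⁗∕Co∕CoP storeys being the instances `Θ := (Stage13Params · N)` (21ᴳ stays in the tree as their context; same statements, same proofs).

CONTENT (all `hpin`∕`hconst`-generic in the reading `rr`; `N`-, `Θ`-, `P`-, `A`-generic; the K3 instance is `N = 2`).
§1 CONSTANT NE3 LAYERS — `n16_tupleReading_iff_of_constLayer` (`∀ F θ (hP : P F θ), A F θ → ∀ g₀ os, N16At (rr F θ hP g₀ os).ne3` ↔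
   `∀ F, (∃ θ, P F θ ∧ A F θ) → N16At (ne3OfRecord₁₁ F (o F))`), `n16_tupleReadingOn_iff_of_constLayer` (regime `Rg F θ` inside), `n16At_of_n16_tupleReading_constLayer`.
§2 AT RR-1's NE3 OBJECT OF RECORD, THE N16 LINE (β = 1, the decl of record), LINEAR CURRENCY — ★ `n16_tupleReading_ofRecord_of_window_linear` (N05's `Thm4Body` ∕ `Prop3Body`
   on the univ sub-family of `zdGF3 (M_N ℂ) F.L 1 (len F)` + N07's `LeafH3sup` ONCE per family carrying an `A`-admissible key with proviso `P` ⇒ the N16 conjunct of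
   `KeyedRates rr`; every other hypothesis a DISPLAYED letter line), ★ `n16_tupleReadingOn_ofRecord_of_window_linear` (guarded), `n16_tupleReading_ofRecord_of_leafSlot`,
   `covRoot_tupleReading_ofRecord` (N21's face at RR-1's period `2·L^m`, letters `ℓ F`, data `ne3DomOfRecord₁₁ F N 0 0`).  NOTE (this seat's LOCATED-4 ∕ dag-n16-c F49): the
   univ-sub-family N05 conjunct makes these two ★ lines VACUOUS as stated; the LIVE lines (N05 conjunct at the pinned all-torus proper sub-index) are the `…AllTorus…` modules.
§3 AT A PRINTED HÖLDER EXPONENT `β ∈ [0, 1]` — `n16Holder_tupleReading_iff_ofRecord`, ★ `n16Holder_tupleReading_ofRecord_of_window_linear`,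
   ★ `n16Holder_tupleReadingOn_ofRecord_of_window_linear`, `covRootHolder_tupleReading_ofRecord` (N21's β-face), `n16Holder_tupleReading_of_n16` (`β ≤ 1` weakening).
§4 HONESTY (R422) — `n16_tupleReading_of_no_admissible`: if NO family carries an `A`-admissible key with proviso `P`, the conjunct holds for EVERY `(Θ, P)`-keyed reading, content-free.

HONEST FRAMING.  Kernel bookkeeping by name; no estimate; N05's `Thm4Body` ∕ `Prop3Body` ([Balaban1985RegularSpaces] Thm 4 ∕ Prop 3 as typed by n05-a, all-torus sub-family)
and N07's `LeafH3sup` ([Balaban1985Variational] Thm 1 (8)+(10) TYPE) are HYPOTHESES asserted for no family; `InEndRegime(H)` = THE END's thresholds; the reading `rr`, the key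
type `Θ`, the proviso `P` and the admissibility `A` are PARAMETERS (`rr` pinned only through `hpin`); no admissible key with ANY proviso is claimed to exist (K0 OPEN at every
edition) — by §4 the conjunct is VACUOUS where none exists; LOCATED (this seat g2; dag-n16-c): the (42)∕(0.4) averaging transfer sits in N21's displayed `hdict`, the
Hölder-exponent pin awaits R-β — both untouched; **N16 ∕ NE3 is NOT discharged**; no `stub_rates13` is claimed (five more conjuncts and the reading's other components are other
seats'); count-neutral; one finite four-torus at fixed ε — NOT ℝ⁴, NOT infinite volume, NOT OS, NOT a mass gap, NOT Clay.
-/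


set_option autoImplicit false

open scoped BigOperators Matrix Matrix.Norms.L2Operator
open NormedSpace

namespace Summit.QuantumFields.YangMills.BalabanUVNodes.N16AtTupleReadingBinderGeneric

open Literature.MathematicalPhysics.QuantumFieldTheory.Balaban1983to89
open Literature.MathematicalPhysics.QuantumFieldTheory.Balaban1983to89.T4Continuum (T4Family ULoop)
open B7Prop1Explicit B7Prop2Explicit
open B7Prop3Flat (c3)
open B8LeafModelZd (ZdIdx)
open B8LeafModelZd3 (zdGF3)
open Node00 (NE3Objects₁₁ NE3Letters₁₁ ne3LOfRecord₁₁ ne3ConstLayerOfRecord₁₁ ne3NperOfRecord₁₁ ne3DomOfRecord₁₁ two_le_ne3LOfRecord₁₁)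
open Summit.QuantumFields.BalabanUV.T4Continuum
open MinimalActionRate (sfClass)
open BlockAverageCurrent (curConst)
open NE3RightInverseSupLetters (frameC)
open NE3.LeafIndexSockets (LeafH3sup)
open NE3EnergyWeightedCovShape (NE3EnergyRateWCov)
open YMDAG.UVSplit (NE3Carriers RateCarriers N16At ne3OfRecord₁₁)
open Summit.QuantumFields.YangMills.BalabanUVNodes.N16Regime (InEndRegime radiusOfRecord constOfRecord)
open Summit.QuantumFields.YangMills.BalabanUVNodes.N16LeafSlot (LeafSlot n16At_of_inEndRegime_leafSlot)
open Summit.QuantumFields.YangMills.BalabanUVNodes.N16AtRRec12OfRecord (inEndRegime_ofRecord_of_letters)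
open Summit.QuantumFields.YangMills.BalabanUVNodes.N16HolderDefs (CovRootHolder N16HolderAt n16HolderAt_of_n16At)
open Summit.QuantumFields.YangMills.BalabanUVNodes.N16HolderRegime (InEndRegimeH radiusOfRecordH constOfRecordH)
open Summit.QuantumFields.YangMills.BalabanUVNodes.N16HolderLeafSlot (LeafSlotHolder n16HolderAt_of_inEndRegimeH_leafSlotHolder)
open Summit.QuantumFields.YangMills.BalabanUVNodes.N16SlotWindowLinear (inEndRegime_and_leafSlot_ofRecord_of_window_linear)
open Summit.QuantumFields.YangMills.BalabanUVNodes.N16HolderSlotWindow (inEndRegimeH_and_leafSlotHolder_ofRecord_of_window_linear)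

noncomputable section

variable {N : ℕ} [NeZero N] {Θ : T4Family → Type*} {P A : (F : T4Family) → Θ F → Prop}
  (rr : (F : T4Family) → (θ : Θ F) → P F θ → (ℕ → ℝ) → List (ULoop F) → RateCarriers N)
  (Rg : (F : T4Family) → Θ F → Prop)

/-! ## §1 Constant NE3 layers: the N16 conjunct of `KeyedRates rr` is one sentence per family -/

section ConstLayer

variable (o : T4Family → NE3Objects₁₁ N)
  (hconst : ∀ (F : T4Family) (θ : Θ F) (hP : P F θ) (g₀ : ℕ → ℝ) (os : List (ULoop F)), (rr F θ hP g₀ os).ne3 = ne3OfRecord₁₁ F (o F))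
include hconst

omit [NeZero N] in
/-- **FOR A TUPLE READING WITH CONSTANT NE3 COMPONENT `ne3OfRecord₁₁ F (o F)`, THE N16 CONJUNCT OF `KeyedRates rr` IS ONE `N16At` PER FAMILY CARRYING AN `A`-ADMISSIBLE KEY
`θ : Θ F` WITH PROVISO `P`** (the K3 skeletons' binder shape, unguarded; ANY key type `Θ`, proviso `P`, admissibility `A`). [folklore] -/
theorem n16_tupleReading_iff_of_constLayer :
    (∀ (F : T4Family) (θ : Θ F) (hP : P F θ), A F θ → ∀ (g₀ : ℕ → ℝ) (os : List (ULoop F)), N16At (rr F θ hP g₀ os).ne3) ↔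
      ∀ (F : T4Family), (∃ θ : Θ F, P F θ ∧ A F θ) → N16At (ne3OfRecord₁₁ F (o F)) := by
  constructor
  · rintro h F ⟨θ, hP, hθ⟩
    have h' := h F θ hP hθ (fun _ => 0) []
    rwa [hconst] at h'
  · intro h F θ hP hθ g₀ os
    rw [hconst]
    exact h F ⟨θ, hP, hθ⟩

omit [NeZero N] in
/-- **THE SAME WITH A REGIME `Rg F θ` INSIDE THE BINDER** (the guarded θ-form a K1-style closer or a (T-SPINE) `SRec₁₃…On`-composer reads). [folklore] -/
theorem n16_tupleReadingOn_iff_of_constLayer :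
    (∀ (F : T4Family) (θ : Θ F) (hP : P F θ), Rg F θ → A F θ → ∀ (g₀ : ℕ → ℝ) (os : List (ULoop F)), N16At (rr F θ hP g₀ os).ne3) ↔
      ∀ (F : T4Family), (∃ θ : Θ F, P F θ ∧ Rg F θ ∧ A F θ) → N16At (ne3OfRecord₁₁ F (o F)) := by
  constructor
  · rintro h F ⟨θ, hP, hRg, hθ⟩
    have h' := h F θ hP hRg hθ (fun _ => 0) []
    rwa [hconst] at h'
  · intro h F θ hP hRg hθ g₀ os
    rw [hconst]
    exact h F ⟨θ, hP, hRg, hθ⟩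

omit [NeZero N] in
/-- **READ-OUT**: under the N16 conjunct of `KeyedRates rr`, `N16At (ne3OfRecord₁₁ F (o F))` at every family with an `A`-admissible key with proviso `P`. [folklore] -/
theorem n16At_of_n16_tupleReading_constLayer
    (h : ∀ (F : T4Family) (θ : Θ F) (hP : P F θ), A F θ → ∀ (g₀ : ℕ → ℝ) (os : List (ULoop F)), N16At (rr F θ hP g₀ os).ne3)
    (F : T4Family) {θ : Θ F} (hP : P F θ) (hθ : A F θ) : N16At (ne3OfRecord₁₁ F (o F)) :=
  (n16_tupleReading_iff_of_constLayer rr o hconst).1 h F ⟨θ, hP, hθ⟩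

end ConstLayer

/-! ## §2 At RR-1's NE3 object of record: THE N16 LINE in the K3 tuple currency (any key ∕ proviso ∕ admissibility `Θ, P, A`) (β = 1, the decl of record), linear letters -/

section OfRecord

variable (ℓ : T4Family → NE3Letters₁₁)
  (hpin : ∀ (F : T4Family) (θ : Θ F) (hP : P F θ) (g₀ : ℕ → ℝ) (os : List (ULoop F)),
    (rr F θ hP g₀ os).ne3 = ne3OfRecord₁₁ F (ne3ConstLayerOfRecord₁₁ F N (ℓ F)))
include hpin

/-- **THE N16 CONJUNCT FROM `LeafSlot` AT LETTERS INSIDE THE TOLERANCE** — letters `⟨r, b F, g F, C F, r, Λ₂' F⟩`-style conditions `0 < g`, `0 ≤ b ≤ r∕2`, `Cof g ≤ C` are NOT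
needed here: the proviso is asked explicitly alongside the slot, once per family carrying an `A`-admissible key with proviso `P`. [folklore] -/
theorem n16_tupleReading_ofRecord_of_leafSlot
    (h : ∀ (F : T4Family), (∃ θ : Θ F, P F θ ∧ A F θ) →
      InEndRegime (ne3OfRecord₁₁ F (ne3ConstLayerOfRecord₁₁ F N (ℓ F))) ∧ LeafSlot (ne3OfRecord₁₁ F (ne3ConstLayerOfRecord₁₁ F N (ℓ F)))) :
    ∀ (F : T4Family) (θ : Θ F) (hP : P F θ), A F θ → ∀ (g₀ : ℕ → ℝ) (os : List (ULoop F)), N16At (rr F θ hP g₀ os).ne3 :=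
  (n16_tupleReading_iff_of_constLayer rr (fun F => ne3ConstLayerOfRecord₁₁ F N (ℓ F)) hpin).2 fun F hF => n16At_of_inEndRegime_leafSlot (h F hF).1 (h F hF).2

omit [NeZero N] in
/-- **N21's FACE AT THE TUPLE READING**: under the N16 conjunct of `KeyedRates rr`, at every family with an `A`-admissible key with proviso `P` the covariant root at RR-1's period
`ne3NperOfRecord₁₁ F 0 0 = 2·L^m`, the letters `ℓ F` and the data of record `ne3DomOfRecord₁₁ F N 0 0` (`N16At` unfolded at the object of record). [folklore] -/
theorem covRoot_tupleReading_ofRecord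
    (h : ∀ (F : T4Family) (θ : Θ F) (hP : P F θ), A F θ → ∀ (g₀ : ℕ → ℝ) (os : List (ULoop F)), N16At (rr F θ hP g₀ os).ne3)
    (F : T4Family) {θ : Θ F} (hP : P F θ) (hθ : A F θ) :
    NE3EnergyRateWCov 4 (sfClass 4 (ne3LOfRecord₁₁ F) (ne3NperOfRecord₁₁ F 0 0) (ℓ F).ε) (ne3LOfRecord₁₁ F) (ne3NperOfRecord₁₁ F 0 0) (ℓ F).b (ℓ F).g (ℓ F).C
      (ℓ F).Λ₁ (ℓ F).Λ₂' (ne3DomOfRecord₁₁ F N 0 0) :=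
  n16At_of_n16_tupleReading_constLayer rr (fun F => ne3ConstLayerOfRecord₁₁ F N (ℓ F)) hpin h F hP hθ

variable
  -- N05's constants, per family; the averaging letter in N05's window and N07's leaf letters, per family (this seat's file 17, verbatim)
  {len : T4Family → Site 4 → ℝ} {c₁ c₁' B₁' cP C₂ B₀β : T4Family → ℝ} {inp : T4Family → B8.B9Inputs} {α b' c' : T4Family → ℝ}
  (hlen : ∀ (F : T4Family) (v : Site 4), 0 < len F v → 1 ≤ len F v) (hlen1 : ∀ (F : T4Family) (μ : Fin 4), len F (e μ) = 1)
  (hB₁' : ∀ F, 0 < B₁' F) (hBB : ∀ F : T4Family, 5 * ((4 : ℕ) : ℝ) * F.L * (inp F).B₀ ≤ B₁' F) (hc₁' : ∀ F, 0 < c₁' F)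
  (hwin : ∀ (F : T4Family) (α₀ α₁ : ℝ), 0 < α₀ → 0 < α₁ → α₀ + α₁ ≤ c₁' F →
    α₀ + α₁ ≤ c₁ F ∧ C0 4 * (2 * α₀) ≤ 1 / 3 ∧ 4 * α₀ ≤ c2' 4 F.L ∧ 16 * (B₁' F * (α₀ + α₁)) ≤ 1 ∧
    Real.exp (4 * (800 * (((4 : ℕ) : ℝ) + 1) ^ 2 * (((4 : ℕ) : ℝ) + 4)) * α₀) * (1 + 8 * (131072 * (((4 : ℕ) : ℝ) + 1) ^ 2) * (B₁' F * (α₀ + α₁))) ≤ 2 ∧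
    2 * (B₁' F * (α₀ + α₁)) ≤ c3 4 F.L ∧ ((4 : ℕ) : ℝ) * F.L * α₁ ≤ 1 / 8 ∧ α₀ ≤ cP F ∧ α₁ ≤ cP F ∧ B₁' F * (α₀ + α₁) ≤ cP F ∧
    2 * (B₁' F * (α₀ + α₁)) ^ 2 + 20 * ((4 : ℕ) : ℝ) * α₀ * (B₁' F * (α₀ + α₁)) + 2 * C₂ F * (B₁' F * (α₀ + α₁)) ^ 2 ≤ α₀ + α₁)
  (hα : ∀ F, 0 < α F) (hα1 : ∀ F, α F ≤ c₁' F / 177)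
  (hα2 : ∀ F : T4Family, α F ≤ (ℓ F).Λ₁ / (1770 * (5 * ((4 : ℕ) : ℝ) * F.L * (inp F).B₀) + 1))
  (hα3 : ∀ F : T4Family, α F ≤ c2' 4 F.L / 2)
  (hα4 : ∀ F : T4Family, α F ≤ 1 / ((23040 * (4 : ℝ) ^ 4 * (frameC 4 F.L + 4) ^ 3 + 12) * (1 + curConst 4 F.L) + 1))
  (hα5 : ∀ F, α F ≤ 1 / 10 ^ 9)
  (hg : ∀ F, 0 < (ℓ F).g) (hε0 : ∀ F, 0 < (ℓ F).ε) (hε : ∀ F, (ℓ F).ε < α F)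
  (hb : ∀ F, 0 ≤ (ℓ F).b ∧ (ℓ F).b ≤ (ℓ F).ε / 2)
  (hΛ₂' : ∀ F : T4Family, 177 * α F * (5 * ((4 : ℕ) : ℝ) * F.L * B₀β F + 5 * ((4 : ℕ) : ℝ) * F.L * (inp F).B₀) ≤ (ℓ F).Λ₂')
  (hb' : ∀ F, 0 ≤ b' F ∧ b' F ≤ α F / 2048) (hc' : ∀ F, 0 ≤ c' F ∧ c' F ≤ α F / 24)

section RecordExponent

variable (hΛ₁r : ∀ F : T4Family, (ℓ F).Λ₁ ≤ radiusOfRecord N F.L (ne3NperOfRecord₁₁ F 0 0))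
  (hC : ∀ F : T4Family, constOfRecord N F.L (ne3NperOfRecord₁₁ F 0 0) (ℓ F).g ≤ (ℓ F).C)
include hlen hlen1 hB₁' hBB hc₁' hwin hα hα1 hα2 hα3 hα4 hα5 hg hε0 hε hb hΛ₂' hb' hc' hΛ₁r hC

/-- ★ **THE N16 LINE IN THE K3 TUPLE CURRENCY, ANY KEY TYPE `Θ`, PROVISO `P`, ADMISSIBILITY `A`** — for ANY `(Θ, P)`-keyed tuple reading `rr` pinned at RR-1's object of record with windowed letters `ℓ F`, the three content clauses
(N05's `Thm4Body` ∕ `Prop3Body` on the univ sub-family of `zdGF3 (M_N ℂ) F.L 1 (len F)`, N07's `LeafH3sup` at `(ℓ F).ε, b' F, c' F`) ONCE per family carrying an `A`-admissible key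
with proviso `P` give the N16 conjunct of `KeyedRates rr` — `∀ F θ hP, A F θ → ∀ g₀ os, N16At (rr F θ hP g₀ os).ne3`; every other hypothesis is a displayed letter line
(file 17's STAGE-FREE per-family lemma `inEndRegime_and_leafSlot_ofRecord_of_window_linear`, the closer `n16At_of_inEndRegime_leafSlot`). [folklore] -/
theorem n16_tupleReading_ofRecord_of_window_linear
    (hcontent : ∀ (F : T4Family), (∃ θ : Θ F, P F θ ∧ A F θ) →
      letI : CStarAlgebra (Matrix (Fin N) (Fin N) ℂ) := {}
      B8.Thm4Body (c₁ F) (B₁' F) (fun i : {i : ZdIdx 4 F.L // i.Ω 0 = Set.univ} => (zdGF3 (Matrix (Fin N) (Fin N) ℂ) F.L 1 (len F) i.1).toGFData) ∧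
        B8.Prop3Body (cP F) 4 (F.L : ℝ) (C₂ F) (inp F) (B₀β F)
          (fun i : {i : ZdIdx 4 F.L // i.Ω 0 = Set.univ} => (zdGF3 (Matrix (Fin N) (Fin N) ℂ) F.L 1 (len F) i.1).toGFData2) ∧
        LeafH3sup 4 F.L (ne3NperOfRecord₁₁ F 0 0) (ℓ F).ε (b' F) (c' F) (ne3DomOfRecord₁₁ F N 0 0)) :
    ∀ (F : T4Family) (θ : Θ F) (hP : P F θ), A F θ → ∀ (g₀ : ℕ → ℝ) (os : List (ULoop F)), N16At (rr F θ hP g₀ os).ne3 :=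
  (n16_tupleReading_iff_of_constLayer rr (fun F => ne3ConstLayerOfRecord₁₁ F N (ℓ F)) hpin).2 fun F hF =>
    have h := inEndRegime_and_leafSlot_ofRecord_of_window_linear ℓ hlen hlen1 hB₁' hBB hc₁' hwin hα hα1 hα2 hα3 hα4 hα5 hg hε0 hε hΛ₁r hb hC hΛ₂' hb' hc' F
      (hcontent F hF).1 (hcontent F hF).2.1 (hcontent F hF).2.2
    n16At_of_inEndRegime_leafSlot h.1 h.2

/-- ★ **THE N16 LINE IN THE GUARDED θ-FORM** — the same with a regime `Rg F θ` inside the binder; content asked only of families carrying a GUARDED `A`-admissible key with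
proviso `P` (e.g. RR-2's guard of record of the edition: `θ.ZtUnity F N ∧ θ.SlotsNondegenerate₁₃ F N` at ⁵, `θ.ZrUnity F N ∧ …` at ⁶). [folklore] -/
theorem n16_tupleReadingOn_ofRecord_of_window_linear
    (hcontent : ∀ (F : T4Family), (∃ θ : Θ F, P F θ ∧ Rg F θ ∧ A F θ) →
      letI : CStarAlgebra (Matrix (Fin N) (Fin N) ℂ) := {}
      B8.Thm4Body (c₁ F) (B₁' F) (fun i : {i : ZdIdx 4 F.L // i.Ω 0 = Set.univ} => (zdGF3 (Matrix (Fin N) (Fin N) ℂ) F.L 1 (len F) i.1).toGFData) ∧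
        B8.Prop3Body (cP F) 4 (F.L : ℝ) (C₂ F) (inp F) (B₀β F)
          (fun i : {i : ZdIdx 4 F.L // i.Ω 0 = Set.univ} => (zdGF3 (Matrix (Fin N) (Fin N) ℂ) F.L 1 (len F) i.1).toGFData2) ∧
        LeafH3sup 4 F.L (ne3NperOfRecord₁₁ F 0 0) (ℓ F).ε (b' F) (c' F) (ne3DomOfRecord₁₁ F N 0 0)) :
    ∀ (F : T4Family) (θ : Θ F) (hP : P F θ), Rg F θ → A F θ →
      ∀ (g₀ : ℕ → ℝ) (os : List (ULoop F)), N16At (rr F θ hP g₀ os).ne3 :=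
  (n16_tupleReadingOn_iff_of_constLayer rr Rg (fun F => ne3ConstLayerOfRecord₁₁ F N (ℓ F)) hpin).2 fun F hF =>
    have h := inEndRegime_and_leafSlot_ofRecord_of_window_linear ℓ hlen hlen1 hB₁' hBB hc₁' hwin hα hα1 hα2 hα3 hα4 hα5 hg hε0 hε hΛ₁r hb hC hΛ₂' hb' hc' F
      (hcontent F hF).1 (hcontent F hF).2.1 (hcontent F hF).2.2
    n16At_of_inEndRegime_leafSlot h.1 h.2

end RecordExponent

/-! ## §3 At a printed Hölder exponent `β ∈ [0, 1]` (dag-n16-c's `N16HolderAt · β`; R-β unruled) -/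

section HolderExponent

omit [NeZero N] hpin in
/-- **FOR A TUPLE READING PINNED AT THE OBJECT OF RECORD, THE β-CONJUNCT IS ONE `N16HolderAt … β` PER FAMILY CARRYING AN `A`-ADMISSIBLE KEY WITH PROVISO `P`.** [folklore] -/
theorem n16Holder_tupleReading_iff_ofRecord (β : ℝ)
    (hpin : ∀ (F : T4Family) (θ : Θ F) (hP : P F θ) (g₀ : ℕ → ℝ) (os : List (ULoop F)),
      (rr F θ hP g₀ os).ne3 = ne3OfRecord₁₁ F (ne3ConstLayerOfRecord₁₁ F N (ℓ F))) :
    (∀ (F : T4Family) (θ : Θ F) (hP : P F θ), A F θ → ∀ (g₀ : ℕ → ℝ) (os : List (ULoop F)), N16HolderAt (rr F θ hP g₀ os).ne3 β) ↔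
      ∀ (F : T4Family), (∃ θ : Θ F, P F θ ∧ A F θ) → N16HolderAt (ne3OfRecord₁₁ F (ne3ConstLayerOfRecord₁₁ F N (ℓ F))) β := by
  constructor
  · rintro h F ⟨θ, hP, hθ⟩
    have h' := h F θ hP hθ (fun _ => 0) []
    rwa [hpin] at h'
  · intro h F θ hP hθ g₀ os
    rw [hpin]
    exact h F ⟨θ, hP, hθ⟩

omit [NeZero N] hpin in
/-- **N21's β-FACE AT THE TUPLE READING**: under the β-conjunct, at every family with an `A`-admissible key with proviso `P` the β-root `CovRootHolder` at RR-1's period, letters `ℓ F`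
and data `ne3DomOfRecord₁₁ F N 0 0` (`N16HolderAt` unfolded — what dag-n21-d's `…N21HolderWidth` reads). [folklore] -/
theorem covRootHolder_tupleReading_ofRecord (β : ℝ)
    (hpin : ∀ (F : T4Family) (θ : Θ F) (hP : P F θ) (g₀ : ℕ → ℝ) (os : List (ULoop F)),
      (rr F θ hP g₀ os).ne3 = ne3OfRecord₁₁ F (ne3ConstLayerOfRecord₁₁ F N (ℓ F)))
    (h : ∀ (F : T4Family) (θ : Θ F) (hP : P F θ), A F θ → ∀ (g₀ : ℕ → ℝ) (os : List (ULoop F)), N16HolderAt (rr F θ hP g₀ os).ne3 β)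
    (F : T4Family) {θ : Θ F} (hP : P F θ) (hθ : A F θ) :
    CovRootHolder 4 (sfClass 4 (ne3LOfRecord₁₁ F) (ne3NperOfRecord₁₁ F 0 0) (ℓ F).ε) (ne3LOfRecord₁₁ F) (ne3NperOfRecord₁₁ F 0 0) (ℓ F).b (ℓ F).g (ℓ F).C
      (ℓ F).Λ₁ (ℓ F).Λ₂' β (ne3DomOfRecord₁₁ F N 0 0) :=
  (n16Holder_tupleReading_iff_ofRecord rr ℓ β hpin).1 h F ⟨θ, hP, hθ⟩

omit [NeZero N] in
/-- **THE `β ≤ 1` WEAKENING AT THE TUPLE READING**: the N16 conjunct of `KeyedRates rr` implies the β-conjunct for every `β ≤ 1`, provided the letters carry a non-negative Hölder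
letter `0 ≤ (ℓ F).Λ₂'` (dag-n16-c's `N16HolderDefs.n16HolderAt_of_n16At`; the block factor `ne3LOfRecord₁₁ F ≥ 2` is RR-1's).
[folklore] -/
theorem n16Holder_tupleReading_of_n16 {β : ℝ} (hβ : β ≤ 1) (hΛ : ∀ F : T4Family, 0 ≤ (ℓ F).Λ₂')
    (h : ∀ (F : T4Family) (θ : Θ F) (hP : P F θ), A F θ → ∀ (g₀ : ℕ → ℝ) (os : List (ULoop F)), N16At (rr F θ hP g₀ os).ne3) :
    ∀ (F : T4Family) (θ : Θ F) (hP : P F θ), A F θ → ∀ (g₀ : ℕ → ℝ) (os : List (ULoop F)), N16HolderAt (rr F θ hP g₀ os).ne3 β := by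
  intro F θ hP hθ g₀ os
  have h16 := h F θ hP hθ g₀ os
  rw [hpin] at h16 ⊢
  exact n16HolderAt_of_n16At h16 (le_trans one_le_two (two_le_ne3LOfRecord₁₁ F)) hβ (hΛ F)

variable {β : ℝ} (hβ0 : 0 ≤ β) (hβ1 : β ≤ 1)
  (hΛ₁rH : ∀ F : T4Family, (ℓ F).Λ₁ ≤ radiusOfRecordH N F.L (ne3NperOfRecord₁₁ F 0 0))
  (hCH : ∀ F : T4Family, constOfRecordH N F.L (ne3NperOfRecord₁₁ F 0 0) (ℓ F).g ≤ (ℓ F).C)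
include hβ0 hβ1 hlen hlen1 hB₁' hBB hc₁' hwin hα hα1 hα2 hα3 hα4 hα5 hg hε0 hε hb hΛ₂' hb' hc' hΛ₁rH hCH

/-- ★ **THE N16 LINE AT EXPONENT `β ∈ [0, 1]` IN THE K3 TUPLE CURRENCY, ANY KEY TYPE `Θ`, PROVISO `P`, ADMISSIBILITY `A`** — N05's family at `zdGF3 (M_N ℂ) F.L β (len F)`, (E1)'s β-uniform thresholds `radiusOfRecordH` ∕
`constOfRecordH`, N07's leaf letters linear; the three content clauses once per family carrying an `A`-admissible key with proviso `P` give the β-conjunct at the tuple reading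
(file 18's STAGE-FREE per-family lemma `inEndRegimeH_and_leafSlotHolder_ofRecord_of_window_linear`, dag-n16-c's closer `n16HolderAt_of_inEndRegimeH_leafSlotHolder`). [folklore] -/
theorem n16Holder_tupleReading_ofRecord_of_window_linear
    (hcontent : ∀ (F : T4Family), (∃ θ : Θ F, P F θ ∧ A F θ) →
      letI : CStarAlgebra (Matrix (Fin N) (Fin N) ℂ) := {}
      B8.Thm4Body (c₁ F) (B₁' F) (fun i : {i : ZdIdx 4 F.L // i.Ω 0 = Set.univ} => (zdGF3 (Matrix (Fin N) (Fin N) ℂ) F.L β (len F) i.1).toGFData) ∧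
        B8.Prop3Body (cP F) 4 (F.L : ℝ) (C₂ F) (inp F) (B₀β F)
          (fun i : {i : ZdIdx 4 F.L // i.Ω 0 = Set.univ} => (zdGF3 (Matrix (Fin N) (Fin N) ℂ) F.L β (len F) i.1).toGFData2) ∧
        LeafH3sup 4 F.L (ne3NperOfRecord₁₁ F 0 0) (ℓ F).ε (b' F) (c' F) (ne3DomOfRecord₁₁ F N 0 0)) :
    ∀ (F : T4Family) (θ : Θ F) (hP : P F θ), A F θ →
      ∀ (g₀ : ℕ → ℝ) (os : List (ULoop F)), N16HolderAt (rr F θ hP g₀ os).ne3 β :=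
  (n16Holder_tupleReading_iff_ofRecord rr ℓ β hpin).2 fun F hF =>
    have h := inEndRegimeH_and_leafSlotHolder_ofRecord_of_window_linear ℓ hlen hlen1 hB₁' hBB hc₁' hwin hα hα1 hα2 hα3 hα4 hα5 hg hε0 hε hΛ₁rH hb hCH hΛ₂' hb' hc' F
      (hcontent F hF).1 (hcontent F hF).2.1 (hcontent F hF).2.2
    n16HolderAt_of_inEndRegimeH_leafSlotHolder h.1 hβ0 hβ1 h.2

/-- ★ **THE N16 LINE AT EXPONENT `β`, GUARDED θ-FORM** (regime `Rg F θ` inside the binder). [folklore] -/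
theorem n16Holder_tupleReadingOn_ofRecord_of_window_linear
    (hcontent : ∀ (F : T4Family), (∃ θ : Θ F, P F θ ∧ Rg F θ ∧ A F θ) →
      letI : CStarAlgebra (Matrix (Fin N) (Fin N) ℂ) := {}
      B8.Thm4Body (c₁ F) (B₁' F) (fun i : {i : ZdIdx 4 F.L // i.Ω 0 = Set.univ} => (zdGF3 (Matrix (Fin N) (Fin N) ℂ) F.L β (len F) i.1).toGFData) ∧
        B8.Prop3Body (cP F) 4 (F.L : ℝ) (C₂ F) (inp F) (B₀β F)
          (fun i : {i : ZdIdx 4 F.L // i.Ω 0 = Set.univ} => (zdGF3 (Matrix (Fin N) (Fin N) ℂ) F.L β (len F) i.1).toGFData2) ∧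
        LeafH3sup 4 F.L (ne3NperOfRecord₁₁ F 0 0) (ℓ F).ε (b' F) (c' F) (ne3DomOfRecord₁₁ F N 0 0)) :
    ∀ (F : T4Family) (θ : Θ F) (hP : P F θ), Rg F θ → A F θ →
      ∀ (g₀ : ℕ → ℝ) (os : List (ULoop F)), N16HolderAt (rr F θ hP g₀ os).ne3 β := by
  intro F θ hP hRg hθ g₀ os
  rw [hpin]
  have h := inEndRegimeH_and_leafSlotHolder_ofRecord_of_window_linear ℓ hlen hlen1 hB₁' hBB hc₁' hwin hα hα1 hα2 hα3 hα4 hα5 hg hε0 hε hΛ₁rH hb hCH hΛ₂' hb' hc' F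
    (hcontent F ⟨θ, hP, hRg, hθ⟩).1 (hcontent F ⟨θ, hP, hRg, hθ⟩).2.1 (hcontent F ⟨θ, hP, hRg, hθ⟩).2.2
  exact n16HolderAt_of_inEndRegimeH_leafSlotHolder h.1 hβ0 hβ1 h.2

end HolderExponent

end OfRecord

/-! ## §4 Honesty (R422): where the conjunct is vacuous -/

omit [NeZero N] in
/-- **IF NO FAMILY CARRIES AN `A`-ADMISSIBLE KEY WITH PROVISO `P`, THE N16 CONJUNCT OF `KeyedRates rr` HOLDS FOR EVERY `(Θ, P)`-KEYED READING — CONTENT-FREE.**  It starts to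
bite exactly where the K0 item of the edition (`Record13…Inhabited`, OPEN at every edition) puts a key. [folklore] -/
theorem n16_tupleReading_of_no_admissible (hno : ∀ (F : T4Family) (θ : Θ F), P F θ → ¬ A F θ) :
    ∀ (F : T4Family) (θ : Θ F) (hP : P F θ), A F θ → ∀ (g₀ : ℕ → ℝ) (os : List (ULoop F)), N16At (rr F θ hP g₀ os).ne3 :=
  fun F θ hP hθ _ _ => absurd hθ (hno F θ hP)

end

end Summit.QuantumFields.YangMills.BalabanUVNodes.N16AtTupleReadingBinderGeneric
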